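import Summits.CriticalPhenomena.PercolationContinuityZ3.Theorems.PercNearOneGluingNoHeavyLowerTailWorstPairExchangeIdentity
import HarnessLib

/-! # Crux `PercNearOneGluing.NoHeavyLowerTail` (stmt-CriticalPhenomena-4575) — two typed bridges:
# (1) event gluing is only needed in the NEAR-ONE REGIME; (2) Kozma–Nitzan QUESTION-5-type CONVEX GLUING suffices

Support file (new-inequality factory seat `prim-ineq-gen-7`; `--supports stmt-CriticalPhenomena-4575`); no definitions, no named facts,
no sorries.

(1) `nearOneGluing_of_eventGluingNearOne`: the landed `Theorems.nearOneGluing_of_eventGluingConst` asks for lossy event gluing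
`μ({o↮c} ∩ {o↔A}) ≤ C·s` (all `μ{a↮c} ≤ s`) on ALL instances; its proof only ever applies it when `μ{o↔A}` and all `μ{a↔c}` are
near one.  We record the regime-restricted form: it suffices to have lossy event gluing, for some absolute `C ≥ 0` and `δ₀ > 0`, on the
instances with `s ≤ δ₀`, `μ{o↔A} ≥ 1−δ₀` and PAIRWISE relay reliability `μ{a↔a'} ≥ 1−δ₀` (the hypotheses of `NoHeavyLowerTail`).  This
licenses regime-restricted certificate targets (ttrl wf3lp 'near-one δ' regime, where e.g. the `(U_1)_3` pseudo-laws disappear at δ = 0.1).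

(2) `eventGluingNearOne_of_convexGluing` + `noHeavyLowerTail_of_nearOneConvexGluing`: Kozma–Nitzan (arXiv:2401.12397 §5.2, Question 5)
ask for coefficients `c_a ≥ 0`, `Σ c_a = 1` with `P(o↔b) ≥ Σ_a c_a P(o↔A, a↔b)`.  We type the (more permissive) signed version as a
sufficient condition for the crux: if in the near-one regime every instance admits weights `λ : A → ℝ` with `Σ λ_a = 1`, `Σ |λ_a| ≤ C`
and `Σ_a λ_a μ({o↔A} ∩ {a↔c}) ≤ μ({o↔A} ∩ {o↔c})` (pre-FKG convex gluing), then event gluing holds there with constant `C`, hence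
`NearOneGluing` and `NoHeavyLowerTail`.  The factory's candidate weights are the normalised 'harmonic' coefficients `ĉ ∝ M⁻¹v`,
`M_{aa'} = μ(o↔A, a↔a')`, `v_a = μ(o↔a)` (KN Theorem 11; memo run/shared/lean/prim/prim-ineq-gen-7/FINDING-KNH.md: valid at |A| = 2 where it
is KN Theorem 1, refuted WITHOUT the regime at |A| = 3 by a dead-end-relay witness, 0 violations in the near-one regime so far).
[cite: KozmaNitzan2024, §5.2 Question 5 and Theorem 11 (pp. 32–34), Conjecture 3 (p. 15), Theorem 1 (p. 7)]
-/

namespace Summit.CriticalPhenomena.PercolationContinuityZ3.Theorems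

open MeasureTheory Set Literature.Probability.LatticeModels Literature.Probability.Percolation

noncomputable section
open Classical

variable {n : ℕ}

namespace NearOneConvexGluing

/-- Pairwise relay reliability from reliability to a common sink: `{a↔c} ∩ {a'↔c} ⊆ {a↔a'}`, hence
`μ{a↔a'} ≥ μ{a↔c} + μ{a'↔c} − 1`. [folklore] -/
theorem real_openConn_ge_of_common_sink (w : Sym2 (Fin n) → unitInterval) (a a' c : Fin n) :
    (prodBernoulli w).real (openConn a c : Set (BondConfig (Fin n))) +
        (prodBernoulli w).real (openConn a' c : Set (BondConfig (Fin n))) - 1 ≤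
      (prodBernoulli w).real (openConn a a' : Set (BondConfig (Fin n))) := by
  set μ := prodBernoulli w with hμ
  haveI : IsProbabilityMeasure μ := by rw [hμ]; infer_instance
  have hsub : (openConn a c : Set (BondConfig (Fin n))) ∩ openConn a' c ⊆ openConn a a' :=
    fun ω hω => (show (openGraph ω).Reachable a c from hω.1).trans (show (openGraph ω).Reachable a' c from hω.2).symm
  have h1 : μ.real ((openConn a c : Set (BondConfig (Fin n))) ∩ openConn a' c) ≤ μ.real (openConn a a' : Set (BondConfig (Fin n))) :=
    measureReal_mono hsub
  have h2 : μ.real ((openConn a c : Set (BondConfig (Fin n))) ∪ openConn a' c) ≤ 1 := measureReal_le_one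
  have h3 : μ.real ((openConn a c : Set (BondConfig (Fin n))) ∪ openConn a' c) +
      μ.real ((openConn a c : Set (BondConfig (Fin n))) ∩ openConn a' c) =
      μ.real (openConn a c : Set (BondConfig (Fin n))) + μ.real (openConn a' c : Set (BondConfig (Fin n))) :=
    measureReal_union_add_inter MeasurableSet.of_discrete
  linarith

/-- **Bridge (1): lossy event gluing is only needed in the near-one regime.**  If for some `C ≥ 0`, `δ₀ > 0`, on every instance with
`s ≤ δ₀`, `μ{o↔A} ≥ 1−δ₀`, pairwise `μ{a↔a'} ≥ 1−δ₀` and all `μ{a↮c} ≤ s` one has `μ({o↮c} ∩ {o↔A}) ≤ C·s`, then `NearOneGluing`.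
[cite: KozmaNitzan2024, Conjecture 3 (p. 15)] -/
theorem nearOneGluing_of_eventGluingNearOne (C δ₀ : ℝ) (hC : 0 ≤ C) (hδ₀ : 0 < δ₀)
    (hEG : ∀ (n : ℕ) (w : Sym2 (Fin n) → unitInterval) (A : Finset (Fin n)) (o c : Fin n) (s : ℝ), 0 ≤ s → s ≤ δ₀ →
      1 - δ₀ ≤ (prodBernoulli w).real (⋃ a ∈ A, (openConn o a : Set (BondConfig (Fin n)))) →
      (∀ a ∈ A, ∀ a' ∈ A, 1 - δ₀ ≤ (prodBernoulli w).real (openConn a a' : Set (BondConfig (Fin n)))) →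
      (∀ a ∈ A, (prodBernoulli w).real (openConn a c : Set (BondConfig (Fin n)))ᶜ ≤ s) →
      (prodBernoulli w).real ((openConn o c : Set (BondConfig (Fin n)))ᶜ ∩ ⋃ a ∈ A, openConn o a) ≤ C * s) :
    Summit.CriticalPhenomena.PercolationContinuityZ3.Theses.PercNearOneGluing.NearOneGluing := by
  intro ε hε
  set δ := min (ε / (2 * (C + 1))) (δ₀ / 2) with hδ
  have hδpos : 0 < δ := lt_min (by positivity) (by positivity)
  have hδ1 : δ ≤ ε / (2 * (C + 1)) := min_le_left _ _
  have hδ2 : δ ≤ δ₀ / 2 := min_le_right _ _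
  refine ⟨δ, hδpos, ?_⟩
  intro n w A o b hoA hAb
  set μ := prodBernoulli w with hμ
  haveI : IsProbabilityMeasure μ := by rw [hμ]; infer_instance
  have hcut : ∀ a ∈ A, μ.real (openConn a b : Set (BondConfig (Fin n)))ᶜ ≤ δ := by
    intro a ha
    have h1 := hAb a ha
    have h2 : μ.real (openConn a b : Set (BondConfig (Fin n)))ᶜ =
        1 - μ.real (openConn a b : Set (BondConfig (Fin n))) :=
      probReal_compl_eq_one_sub MeasurableSet.of_discrete
    linarith
  have hregA : 1 - δ₀ ≤ μ.real (⋃ a ∈ A, (openConn o a : Set (BondConfig (Fin n)))) := by linarith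
  have hregP : ∀ a ∈ A, ∀ a' ∈ A, 1 - δ₀ ≤ μ.real (openConn a a' : Set (BondConfig (Fin n))) := by
    intro a ha a' ha'
    have h := real_openConn_ge_of_common_sink w a a' b
    have h1 := hAb a ha
    have h2 := hAb a' ha'
    rw [← hμ] at h
    linarith
  have hX := hEG n w A o b δ hδpos.le (by linarith) hregA hregP hcut
  have hsplit : μ.real (⋃ a ∈ A, (openConn o a : Set (BondConfig (Fin n)))) ≤
      μ.real (openConn o b : Set (BondConfig (Fin n))) +
        μ.real ((openConn o b : Set (BondConfig (Fin n)))ᶜ ∩ ⋃ a ∈ A, openConn o a) := by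
    calc μ.real (⋃ a ∈ A, (openConn o a : Set (BondConfig (Fin n))))
        ≤ μ.real ((openConn o b : Set (BondConfig (Fin n))) ∪
            ((openConn o b : Set (BondConfig (Fin n)))ᶜ ∩ ⋃ a ∈ A, openConn o a)) := by
          refine measureReal_mono fun ω hω => ?_
          by_cases hob : ω ∈ (openConn o b : Set (BondConfig (Fin n)))
          · exact Or.inl hob
          · exact Or.inr ⟨hob, hω⟩
      _ ≤ _ := measureReal_union_le _ _
  have hCd : (C + 1) * δ ≤ ε / 2 := by
    have h := mul_le_mul_of_nonneg_left hδ1 (by positivity : (0 : ℝ) ≤ C + 1)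
    have h' : (C + 1) * (ε / (2 * (C + 1))) = ε / 2 := by field_simp
    linarith
  nlinarith

/-- **Bridge (2a): convex (signed, ℓ¹-bounded) gluing ⇒ lossy event gluing**, instance by instance: if `Σ_{a∈A} λ_a = 1`,
`Σ |λ_a| ≤ C` and `Σ_a λ_a μ({o↔A} ∩ {a↔c}) ≤ μ({o↔A} ∩ {o↔c})`, and all `μ{a↮c} ≤ s`, then `μ({o↮c} ∩ {o↔A}) ≤ C·s`.
[cite: KozmaNitzan2024, §5.2 Question 5 (p. 32)] -/
theorem eventGluing_of_convexGluing_at (w : Sym2 (Fin n) → unitInterval) (A : Finset (Fin n)) (o c : Fin n) (C s : ℝ)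
    (hs : 0 ≤ s) (hcut : ∀ a ∈ A, (prodBernoulli w).real (openConn a c : Set (BondConfig (Fin n)))ᶜ ≤ s)
    (lam : Fin n → ℝ) (hsum : ∑ a ∈ A, lam a = 1) (hl1 : ∑ a ∈ A, |lam a| ≤ C)
    (hconv : ∑ a ∈ A, lam a * (prodBernoulli w).real ((⋃ x ∈ A, (openConn o x : Set (BondConfig (Fin n)))) ∩ openConn a c) ≤
      (prodBernoulli w).real ((⋃ x ∈ A, (openConn o x : Set (BondConfig (Fin n)))) ∩ openConn o c)) :
    (prodBernoulli w).real ((openConn o c : Set (BondConfig (Fin n)))ᶜ ∩ ⋃ a ∈ A, openConn o a) ≤ C * s := by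
  set μ := prodBernoulli w with hμ
  haveI : IsProbabilityMeasure μ := by rw [hμ]; infer_instance
  set U : Set (BondConfig (Fin n)) := ⋃ x ∈ A, (openConn o x : Set (BondConfig (Fin n))) with hU
  -- μ(U) = μ(U ∩ {x↔c}) + μ(U ∩ {x↔c}ᶜ) for every vertex x
  have hdec : ∀ x : Fin n, μ.real U = μ.real (U ∩ openConn x c) + μ.real (U ∩ (openConn x c : Set (BondConfig (Fin n)))ᶜ) := by
    intro x
    have h := measureReal_inter_add_sdiff (μ := μ) (s := U) (t := (openConn x c : Set (BondConfig (Fin n))))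
      MeasurableSet.of_discrete (measure_ne_top _ _)
    rw [Set.sdiff_eq] at h
    exact h.symm
  -- the complement piece at a relay is at most `s`
  have hsmall : ∀ a ∈ A, μ.real (U ∩ (openConn a c : Set (BondConfig (Fin n)))ᶜ) ≤ s :=
    fun a ha => (measureReal_mono Set.inter_subset_right).trans (hcut a ha)
  -- main computation
  have hLHS : μ.real ((openConn o c : Set (BondConfig (Fin n)))ᶜ ∩ U) = μ.real U - μ.real (U ∩ openConn o c) := by
    rw [hdec o, Set.inter_comm]; ring
  have hstep : μ.real U - μ.real (U ∩ openConn o c) ≤ ∑ a ∈ A, lam a * μ.real (U ∩ (openConn a c : Set (BondConfig (Fin n)))ᶜ) := by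
    have h1 : μ.real U - μ.real (U ∩ openConn o c) ≤ μ.real U - ∑ a ∈ A, lam a * μ.real (U ∩ openConn a c) := by linarith
    have h2 : μ.real U - ∑ a ∈ A, lam a * μ.real (U ∩ openConn a c) =
        ∑ a ∈ A, lam a * μ.real (U ∩ (openConn a c : Set (BondConfig (Fin n)))ᶜ) := by
      have h3 : μ.real U = ∑ a ∈ A, lam a * μ.real U := by rw [← Finset.sum_mul, hsum, one_mul]
      rw [h3, ← Finset.sum_sub_distrib]
      refine Finset.sum_congr rfl fun a _ => ?_
      rw [hdec a]; ring
    linarith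
  have hbound : ∑ a ∈ A, lam a * μ.real (U ∩ (openConn a c : Set (BondConfig (Fin n)))ᶜ) ≤ ∑ a ∈ A, |lam a| * s := by
    refine Finset.sum_le_sum fun a ha => ?_
    have h1 : lam a * μ.real (U ∩ (openConn a c : Set (BondConfig (Fin n)))ᶜ) ≤
        |lam a| * μ.real (U ∩ (openConn a c : Set (BondConfig (Fin n)))ᶜ) :=
      mul_le_mul_of_nonneg_right (le_abs_self _) measureReal_nonneg
    exact h1.trans (mul_le_mul_of_nonneg_left (hsmall a ha) (abs_nonneg _))
  rw [hLHS]
  calc μ.real U - μ.real (U ∩ openConn o c)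
      ≤ ∑ a ∈ A, |lam a| * s := hstep.trans hbound
    _ = (∑ a ∈ A, |lam a|) * s := by rw [Finset.sum_mul]
    _ ≤ C * s := mul_le_mul_of_nonneg_right hl1 hs

/-- **Bridge (2b): near-one convex gluing ⇒ `NoHeavyLowerTail`.**  If for some `C`, `δ₀ > 0`, every near-one instance
(`μ{o↔A} ≥ 1−δ₀`, pairwise `μ{a↔a'} ≥ 1−δ₀`, all `μ{a↮c} ≤ δ₀`) admits weights `λ` with `Σ_{a∈A} λ_a = 1`, `Σ |λ_a| ≤ C` and
`Σ_a λ_a μ({o↔A} ∩ {a↔c}) ≤ μ({o↔A} ∩ {o↔c})`, then `NoHeavyLowerTail` (and `NearOneGluing`).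
[cite: KozmaNitzan2024, §5.2 Question 5 (p. 32), Conjecture 3 (p. 15)] -/
theorem noHeavyLowerTail_of_nearOneConvexGluing (C δ₀ : ℝ) (hC : 0 ≤ C) (hδ₀ : 0 < δ₀)
    (hconv : ∀ (n : ℕ) (w : Sym2 (Fin n) → unitInterval) (A : Finset (Fin n)) (o c : Fin n),
      1 - δ₀ ≤ (prodBernoulli w).real (⋃ a ∈ A, (openConn o a : Set (BondConfig (Fin n)))) →
      (∀ a ∈ A, ∀ a' ∈ A, 1 - δ₀ ≤ (prodBernoulli w).real (openConn a a' : Set (BondConfig (Fin n)))) →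
      (∀ a ∈ A, (prodBernoulli w).real (openConn a c : Set (BondConfig (Fin n)))ᶜ ≤ δ₀) →
      ∃ lam : Fin n → ℝ, ∑ a ∈ A, lam a = 1 ∧ ∑ a ∈ A, |lam a| ≤ C ∧
        ∑ a ∈ A, lam a * (prodBernoulli w).real ((⋃ x ∈ A, (openConn o x : Set (BondConfig (Fin n)))) ∩ openConn a c) ≤
          (prodBernoulli w).real ((⋃ x ∈ A, (openConn o x : Set (BondConfig (Fin n)))) ∩ openConn o c)) :
    Summit.CriticalPhenomena.PercolationContinuityZ3.Theses.PercNearOneGluing.NoHeavyLowerTail := by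
  refine noHeavyLowerTail_of_manyFingersLargePocket
    (manyFingersLargePocket_of_nearOneGluing (nearOneGluing_of_eventGluingNearOne C δ₀ hC hδ₀ ?_))
  intro n w A o c s hs hsδ hregA hregP hcut
  obtain ⟨lam, hsum, hl1, hcv⟩ := hconv n w A o c hregA hregP (fun a ha => (hcut a ha).trans hsδ)
  exact eventGluing_of_convexGluing_at w A o c C s hs hcut lam hsum hl1 hcv

end NearOneConvexGluing

end

end Summit.CriticalPhenomena.PercolationContinuityZ3.Theorems
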